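import Summits.FinalStateConjecture.FinalStateConjecture.Theses.SwallowTheDatum
import Summits.FinalStateConjecture.FinalStateConjecture.Theorems.SwallowTheDatumUniversalWitnessFamily
import Literature.Geometry.Lorentzian.KerrDataProofs
import Literature.Geometry.Lorentzian.KerrSchildCoord

/-!
# Route SwallowTheDatum · item `Assembly` (stmt-FinalStateConjecture-10057) — RETIRED with the route

Pure logic, historically. The route decl
`Summit.FinalStateConjecture.FinalStateConjecture.Theses.SwallowTheDatum.Assembly` first read
`ParametricKerrBurial → KerrShieldedSettles → MGHDExists → FinalStateConjecture`, and
`SwallowTheDatum.assembly_proof` proved it (item stmt-FinalStateConjecture-10057, @ af6bce5f0cc4): the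
three cruxes give the route target `UniversalWitnessFamily` (the burial supplies, through every
admissible datum `d`, a jointly smooth injective admissible family `F` with `F 0 = d` all of whose members
`F c`, `c ≠ 0`, are Kerr-shielded; `MGHDExists` gives the `∃`-MGHD conjunct of the summit conclusion,
`KerrShieldedSettles` its `∀`-MGHD conjunct; the instance `Kerr.Facts` is assembled from the discharged
facts `Kerr.isConnected_region_holds`, `Kerr.contMDiff_bilin_holds`, `Kerr.contMDiff_timeVector_holds`),
and the route's deciding theorem `closes : UniversalWitnessFamily → FinalStateConjecture` finished.

**Repair 2026-08-16 (rev 6).** The route restated the item UNDER THE SAME DECL NAME `Assembly` as the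
frame `UniversalWitnessFamily → FinalStateConjecture` (stmt-FinalStateConjecture-14028); the theorem kept
its name and statement text (Theorems files are append-only) and proved the frame by `closes`, the
crux-to-target reduction being landed separately as
`Theorems.SwallowTheDatum.universalWitnessFamily_of_burial_of_settles_of_mghd`
(`Theorems/SwallowTheDatumUniversalWitnessFamily.lean`).

**Record 2026-08-17 (dependency-drift repair = this revision).** On 2026-08-16T21:18Z the summit
statement `FinalStateConjecture` was RE-TYPED (T2: tame genericity `IsTameChristodoulouGeneric`,
`RaysStayInClosure`, `IsFutureOriented`), which excludes the burial mechanism by design; the route was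
CLOSED `retired — moot` at 21:27Z (kill criterion (e)) and the gate re-rendered its file WITHOUT the
deciding theorem `closes`, which no longer elaborates. Hence `SwallowTheDatum.assembly_proof := closes …`
stopped elaborating (full build 2026-08-17: unknown identifier `…SwallowTheDatum.closes`), and the frame
`Assembly` as now read (`UniversalWitnessFamily → FinalStateConjecture` with the T2 statement) is no longer
a theorem of logic. What survives of the original curried assembly is its reduction to the route target,
`universalWitnessFamily_of_burial_of_settles_of_mghd : ParametricKerrBurial → KerrShieldedSettles →
MGHDExists → UniversalWitnessFamily` (imported; elaborates); the landed name is therefore kept as a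
DEPRECATED ALIAS of that theorem, and `SwallowTheDatum.assembly_iff_frame` records (`Iff.rfl`) what the
decl `Assembly` currently denotes. Nothing here asserts any statement of the retired route.
-/

namespace Summit.FinalStateConjecture.FinalStateConjecture.Theorems

open Literature.Geometry.Lorentzian

/-- **Record: the current reading of the route decl `Assembly`** (retired route SwallowTheDatum,
rev ≥ 6): it is the frame `UniversalWitnessFamily → FinalStateConjecture`, definitionally — with
`FinalStateConjecture` the re-typed (T2) summit statement, under which the frame is no longer provable by
logic (the route's `closes` was withdrawn by the gate when the route was retired). [folklore] -/
theorem SwallowTheDatum.assembly_iff_frame :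
    Summit.FinalStateConjecture.FinalStateConjecture.Theses.SwallowTheDatum.Assembly ↔
      (Summit.FinalStateConjecture.FinalStateConjecture.Theses.SwallowTheDatum.UniversalWitnessFamily →
        _root_.FinalStateConjecture) :=
  Iff.rfl

/-- Deprecated spelling: **item `Assembly`, route SwallowTheDatum** (stmt-FinalStateConjecture-10057 in
its curried form `ParametricKerrBurial → KerrShieldedSettles → MGHDExists → FinalStateConjecture`, proved
@ af6bce5f0cc4; after the rev-6 restate the frame `UniversalWitnessFamily → FinalStateConjecture`,
proved by `closes`). The route was retired after the T2 re-type of the summit statement and its `closes`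
withdrawn, so neither reading elaborates any more; the surviving proved content — the reduction of the
route target to the three cruxes — is `SwallowTheDatum.universalWitnessFamily_of_burial_of_settles_of_mghd`,
of which the old name is kept as a deprecated alias (Theorems files are append-only). -/
@[deprecated SwallowTheDatum.universalWitnessFamily_of_burial_of_settles_of_mghd (since := "2026-08-17")]
alias SwallowTheDatum.assembly_proof :=
  SwallowTheDatum.universalWitnessFamily_of_burial_of_settles_of_mghd

end Summit.FinalStateConjecture.FinalStateConjecture.Theorems
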